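import Summits.QuantumFields.BalabanUV.Beta.EriceRemainderEnclosureHistoryAutonomyComparisonAgeCompositionYoungPairSeparatedAges
import Summits.QuantumFields.BalabanUV.Beta.EriceRemainderEnclosureHistoryAutonomyComparisonAgeCompositionClusterCascadeYoungest

/-!
# EriceRemainderEnclosureHistoryAutonomyComparisonAgeCompositionYoungSeparatedAges — (E96b) route (N), first order: THE YOUNGEST GAP IS CHEAP — A YOUNG AGE
# AT RATIO ≥ 30 (NOT 58) BELOW A SEPARATED CHAIN, AND THE CENSUS YOUNG PAIR `{1, k₂}` AT EVERY `k₂` BELOW A ×92 CHAIN.  Flow instances of (E96a)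
# `renewal_nonneg_cluster_cascade_youngest`: ages `a_0 < a_1 < …` with `a_0 ≥ 1` arbitrary, `a_1 ≥ ρ₀·a_0` and `a_{j+1} ≥ R₀·a_j` above (`(ρ₀, R₀) =
# (30, 61)` at `κ = 1∕5`, `(21, 92)` at `κ = 19∕200`) ⟹ `0 ≤ ε ≤ e` along every admissible flow, every horizon, every damping of the self-consistent class,
# EVERY number of ages; with (E95d) (the pair route, `k₂ ≤ 20` at `κ = 19∕200`, `p₀ = 11∕20`) the census profile `{1, k₂, k₃, …, k_r}` holds the END for
# EVERY `k₂ ≥ 2` as soon as `k_{j+1} ≥ 92·k_j` from `k₂` on — four ages `{1, k₂, k₃, k₄}` with ANY `k₂`, `k₃ ≥ 92k₂`, `k₄ ≥ 92k₃`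

Cell `pub-balaban`, β-function sub-cell, BINDER row D4 «RemainderConst leaves for Bałaban's split» (`HOME/BINDER-OWNERS.md`; owner lineage `b2b-balaban-beta-an4`;
this file by co-owner #2 lineage `b2b-balaban-beta-d4-p2`, generation 85), β-FLOW TEAM duty (1), FREEZE (0) honoured (def-free; nothing restated).

HONEST FRAMING (page 1, verbatim and binding).  *"Discharging BetaPertH makes Bałaban's UV stability UNCONDITIONAL — a real constructive-QFT result; it is
NOT the continuum limit and NOT the Clay problem."*  THIS FILE DISCHARGES NOTHING OF THE KIND.  Elementary real algebra ∕ real analysis about ABSTRACT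
functionals on a box ]0,γ]^ℕ with displayed floors, profiles and signs, and the FIRST-ORDER renewal objects of route (N) built from them — hypotheses of a
census, not facts; the form, signs, ages and moments of Bałaban's (1.22) limit functional are NOT PRINTED ([I] p. 298; GAPS G-t4-U2-1∕-2) and NOT asserted.
Row D4 class UNCHANGED (critical-path width 0; instance 0∕1; D4 DISCHARGE NO DATE).  HONEST DEPENDENCY: continuum YM on T⁴ ⇐ BetaPertH ∧ nine spine
estimates (0/9 proved); BetaPertH ⇐ (D1) ∧ (D4) ∧ CAP+tail; G-an2-4 gates asym, D1 and NE2/3/4.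

THE POINT (README `HOME/b2b-balaban-beta-d4-p2/g85/README.md` §5).  The youngest level of the cascade is the last of the descent; its gap `a_1∕a_0` needs only
`s₀(1 + (4s(1+κ)+κ)∕(ρ₀λ)) ≤ 1` (`s₀ = 0.7072` the young cap, `s` the older cap valid from age `ρ₀` on by (E94b) `load_le_of_sq`, `λ = 1 − s(1+κ)`):
`κ = 1∕5`, `s = 0.6165`, `ρ₀ = 30` (`0.9934 ≤ 1`; older closure at `R₀ = 61`: `3.1591 ≤ 3.1744`); `κ = 19∕200`, `s = 0.6175`, `ρ₀ = 21` (`0.9983 ≤ 1`;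
`R₀ = 92`: `2.7997 ≤ 2.8303`).  At `κ = 19∕200` the pair route of (E95d) (`√2·219∕200 ≤ 31∕20`, `(11∕20)⁴·21 ≤ 2`) serves `k₂ ≤ 20` under the same ×92
chain — so EVERY `k₂`.  Uses (E96a) `renewal_nonneg_cluster_cascade_youngest`, (E95d) `flow_nonneg_young_pair_separated_ages_param`, (E95b)
`old_read_variation_of_bound`∕`aggregate_eq_sum_ages`, (E94b) `load_le_of_sq`, (E82a) `kernel_entry_le`∕`row_mass_le` BY NAME.  NOT CLAIMED: ratios below 92
(resp. 61) in the chain above `k₂`; near OLD pairs; arbitrary dampings; anything nonlinear; anything printed — NOT B12 Thm 2, NOT BetaPertH, NOT continuum, NOT Clay.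

WHAT IS PROVED ([folklore]; 0 `def`, 0 sorry).  §1 **`flow_nonneg_youngest_separated_ages_param`** (parametric `κ, s, ρ₀, R₀`), **`flow_nonneg_youngest_separated_ages`**
(`a_1 ≥ 30a_0`, `a_{j+1} ≥ 61a_j`), `flow_nonneg_youngest_separated_ages_wide` (`a_1 ≥ 21a_0`, `a_{j+1} ≥ 92a_j`).  §2 **`flow_nonneg_census_young_pair_every`**
(`{1, k₂, k₃, …}`: `k₂ ≥ 2`, `k_{j+1} ≥ 92k_j`, every `r`), **`flow_nonneg_census_four_ages_every_young_pair`** (`{1,k₂,k₃,k₄}`: `2 ≤ k₂`, `k₃ ≥ 92k₂`, `k₄ ≥ 92k₃`).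
-/
noncomputable section
open Finset

namespace Summit.QuantumFields.BalabanUV.Beta.EriceRemainderEnclosureHistoryAutonomyComparisonAgeCompositionYoungSeparatedAges

open Literature.MathematicalPhysics.QuantumFieldTheory.Balaban1983to89
open Literature.MathematicalPhysics.QuantumFieldTheory.Balaban1983to89.T4BetaStationary
open Literature.MathematicalPhysics.QuantumFieldTheory.Balaban1983to89.T4BetaFlowWellPosed
open Summit.QuantumFields.BalabanUV.Beta.EriceRemainderEnclosureHistoryAutonomyComparisonAgeCompositionYoungPairMoment (load_le_of_sq)
open Summit.QuantumFields.BalabanUV.Beta.EriceRemainderEnclosureHistoryAutonomyComparisonAgeCompositionYoungestTailSumFlow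
  (kernel_entry_le row_mass_le)
open Summit.QuantumFields.BalabanUV.Beta.EriceRemainderEnclosureHistoryAutonomyComparisonAgeCompositionSeparatedAges
  (old_read_variation_of_bound aggregate_eq_sum_ages)
open Summit.QuantumFields.BalabanUV.Beta.EriceRemainderEnclosureHistoryAutonomyComparisonAgeCompositionYoungPairSeparatedAges
  (flow_nonneg_young_pair_separated_ages_param)
open Summit.QuantumFields.BalabanUV.Beta.EriceRemainderEnclosureHistoryAutonomyComparisonAgeCompositionClusterCascadeYoungest
  (renewal_nonneg_cluster_cascade_youngest)

variable {B : (ℕ → ℝ) → ℝ} {γ b gIR : ℝ} {L : ℕ → ℝ} {K : ℕ} {h g : ℕ → ℝ}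

/-! ## §1 A young age at a cheap ratio below a separated chain -/

/-- **THE YOUNGEST GAP IS CHEAP — PARAMETRIC FORM.**  `B` an isotone memory on the box with floor `b > 0` dominating the profile `L ≥ 0` carried by the ages
`a 0, …, a (r−1)` (`r ≥ 1`, `1 ≤ a 0`, `ρ₀·a 0 ≤ a 1`, `R₀·a j ≤ a (j+1)` for `j ≥ 1`, `a (r−1) < K`, `L l = 0` for the other `l < K`); `h` a box solution;
dampings `0 < g ≤ 1` with `g_t(1 + F_t) ≥ 1`; kernels `KL`, aggregates `KA`, reads `RA`; `e ≥ 0` non-increasing; `ε` the first-order comparison solution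
with zero tail beyond `N`.  Parameters `κ > 0`, `s ≥ 0`, `ρ₀ ≥ 2`, `R₀ ≥ 2` with `s(1+κ) < 1`, the older closure `κ + 4s(1+κ) ≤ R₀(1 − s(1+κ))κ`, the cap
condition `3ρ₀ + 1 ≤ 8ρ₀s²` (so `x_k ≤ s` for every age `k ≥ ρ₀`), and the LAST-STEP condition `0.7072·(ρ₀(1 − s(1+κ)) + 4s(1+κ) + κ) ≤ ρ₀(1 − s(1+κ))`.
THEN `0 ≤ ε ≤ e` at every pin. [folklore] -/
theorem flow_nonneg_youngest_separated_ages_param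
    (hmono : ∀ u v : ℕ → ℝ, SeqBox γ u → SeqBox γ v → (∀ j, u j ≤ v j) → B u ≤ B v)
    (hL : ∀ k, 0 ≤ L k) (hb : 0 < b) (hlo : ∀ u, SeqBox γ u → b ≤ B u) (hdom : ∀ u, SeqBox γ u → ∑ k ∈ range K, L k * u k ≤ B u)
    (hh : SeqBox γ h) (hf : MemFlow B gIR h) (hg : ∀ t, 0 < g t ∧ g t ≤ 1)
    (hgF : ∀ t, 1 ≤ g t * (1 + ∑ k ∈ range K, L k * h (t + k) ^ 3 / 2))
    {κ s : ℝ} {ρ₀ R₀ : ℕ} (hκ : 0 < κ) (hs : 0 ≤ s) (hsC : s * (1 + κ) < 1)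
    (hR : κ + 4 * s * (1 + κ) ≤ (R₀ : ℝ) * (1 - s * (1 + κ)) * κ) (hR2 : 2 ≤ R₀) (hρ2 : 2 ≤ ρ₀)
    (hsq : 3 * (ρ₀ : ℝ) + 1 ≤ 8 * ρ₀ * s ^ 2)
    (hyoung : (7072 / 10000 : ℝ) * ((ρ₀ : ℝ) * (1 - s * (1 + κ)) + (4 * s * (1 + κ) + κ)) ≤ (ρ₀ : ℝ) * (1 - s * (1 + κ)))
    {r : ℕ} {a : ℕ → ℕ} (hr : 1 ≤ r) (ha0 : 1 ≤ a 0) (haK : a (r - 1) < K) (hsep0 : 1 < r → ρ₀ * a 0 ≤ a 1)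
    (hsep : ∀ j, 1 ≤ j → j + 1 < r → R₀ * a j ≤ a (j + 1)) (hLa : ∀ l, l < K → (∀ j, j < r → l ≠ a j) → L l = 0)
    {N : ℕ} {KL : ℕ → ℕ → ℕ → ℝ}
    (hKL : ∀ k n l, KL k n l = if 0 < k ∧ k < K ∧ l < k then L k * h (n + k) ^ 3 / 2 * ∏ t ∈ Ico (n + 1 + l) (n + k + 1), g t else 0)
    {KA : ℕ → ℕ → ℕ → ℝ} {RA : ℕ → (ℕ → ℝ) → ℕ → ℝ}
    (hRA : ∀ i v m, RA i v m = ∑ l ∈ range K, KA i m l * v (m + 1 + l))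
    (hKA : ∀ i m l, KA i m l = KL i m l + KA (i + 1) m l) (hKAtop : ∀ m l, KA K m l = 0)
    {e ε : ℕ → ℝ} (he0 : ∀ m, 0 ≤ e m) (hea : ∀ m, e (m + 1) ≤ e m)
    (hεt : ∀ m, N < m → ε m = 0) (hεrec : ∀ m, ε m = e m - RA 1 ε m) : ∀ m, 0 ≤ ε m ∧ ε m ≤ e m := by
  have hpos : ∀ n, 0 < h n := fun n => (hh n).1
  -- the gap after index j: ρ₀ for j = 0, R₀ above; both ≥ 2
  have hgap : ∀ j, j + 1 < r → 2 * a j ≤ a (j + 1) := by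
    intro j hj
    rcases Nat.eq_zero_or_pos j with rfl | hjp
    · exact le_trans (Nat.mul_le_mul_right _ hρ2) (hsep0 (by omega))
    · exact le_trans (Nat.mul_le_mul_right _ hR2) (hsep j (by omega) hj)
  have hamono : ∀ i j, i ≤ j → j < r → a i ≤ a j := by
    intro i j hij hjr
    induction j, hij using Nat.le_induction with
    | base => exact le_rfl
    | succ j _ ih => have h1 := ih (by omega); have h2 := hgap j hjr; omega
  have hapos : ∀ j, j < r → 1 ≤ a j := fun j hj => ha0.trans (hamono 0 j (Nat.zero_le j) hj)
  have hastrict : ∀ i j, i < j → j < r → a i < a j := by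
    intro i j hij hjr
    have h1 := hamono i (j - 1) (by omega) (by omega)
    have h2 := hgap (j - 1) (by omega)
    have h3 := hapos (j - 1) (by omega)
    rw [Nat.sub_add_cancel (by omega)] at h2
    omega
  have hajK : ∀ j, j < r → a j < K := fun j hj => lt_of_le_of_lt (hamono j (r - 1) (by omega) (by omega)) haK
  have haold : ∀ j, 1 ≤ j → j < r → ρ₀ ≤ a j := by
    intro j hj hjr
    have h1 := hsep0 (by omega)
    have h2 := hamono 1 j hj hjr
    have h3 : ρ₀ ≤ ρ₀ * a 0 := Nat.le_mul_of_pos_right _ (by omega)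
    omega
  have hainj : ∀ i j, i < r → j < r → a i = a j → i = j := by
    intro i j hi hj hij
    by_contra hne
    rcases Nat.lt_or_gt_of_ne hne with h' | h'
    · exact absurd hij (ne_of_lt (hastrict i j h' hj))
    · exact absurd hij.symm (ne_of_lt (hastrict j i h' hi))
  have hK : 1 ≤ K := by have := hajK 0 (by omega); omega
  have hL0 : L 0 = 0 := hLa 0 (by omega) fun j hj h0 => by have := hapos j hj; omega
  -- the older cap is valid from age ρ₀ on
  have hs83 : 0 < 8 * s ^ 2 - 3 := by
    have hρ : (2 : ℝ) ≤ ρ₀ := by exact_mod_cast hρ2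
    by_contra hneg
    have hneg' : 8 * s ^ 2 - 3 ≤ 0 := not_lt.mp hneg
    have : 8 * (ρ₀ : ℝ) * s ^ 2 ≤ 3 * ρ₀ := by nlinarith
    linarith
  have hcapk : ∀ k : ℕ, ρ₀ ≤ k → 3 * (k : ℝ) + 1 ≤ 8 * k * s ^ 2 := by
    intro k hk
    have hk' : (ρ₀ : ℝ) ≤ k := by exact_mod_cast hk
    nlinarith [mul_le_mul_of_nonneg_left hk' hs83.le]
  have hspos : 0 < s := by
    rcases hs.eq_or_lt with h0 | h0
    · rw [← h0] at hs83; norm_num at hs83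
    · exact h0
  -- the reads of the ages
  obtain ⟨O, hO⟩ : ∃ O : ℕ → ℕ → ℝ, ∀ j q, O j q = ∑ l ∈ range K, KL (a j) q l * ε (q + 1 + l) := ⟨_, fun _ _ => rfl⟩
  have hrec : ∀ q, ε q = e q - ∑ j ∈ range r, O j q := by
    intro q
    rw [hεrec q, hRA]
    have : ∑ l ∈ range K, KA 1 q l * ε (q + 1 + l) = ∑ j ∈ range r, O j q := by
      simp_rw [hO, aggregate_eq_sum_ages hKL hKA hKAtop hK (fun j hj => ⟨hapos j hj, hajK j hj⟩) hainj hLa, sum_mul]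
      rw [sum_comm]
    rw [this]
  refine renewal_nonneg_cluster_cascade_youngest (r := r) (N := N) (Kw := K) (R₀ := R₀) (ρ₀ := ρ₀) (κ := κ) (s₀ := 7072 / 10000) (s := s)
    (lo := a) (hi := a) (w := fun j q l => KL (a j) q l) (x := fun j q => (a j : ℝ) * (L (a j) * h (q + a j) ^ 3 / 2))
    (ν := fun j q => 4 * (L (a j) * h (q + a j) ^ 3 / 2)) (O := O) (e := e) (ε := ε)
    hκ hs hsC hR (by omega) hyoung hsep0 hsep (fun j _ _ => le_rfl)
    (fun j q l => (kernel_entry_le hL hh hg hKL (a j) q l).1)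
    (fun j q l hl => by rw [hKL, if_neg (by omega)])
    (fun j q => by have := hL (a j); have := hpos (q + a j); positivity)
    (fun j q => by have := hL (a j); have := hpos (q + a j); positivity)
    (fun j q hj => row_mass_le hL hh hg hKL (hajK j hj) q)
    (fun q => ?_) (fun j q hj1 hjr => ?_) (fun j q _ _ => le_of_eq (by ring)) hO
    (fun j m d T hj1 hjr hd1 hdj hT hnn hle => ?_) he0 hea hεt hrec
  · -- the youngest cap 0.7072 (any age ≥ 1)
    have hk1 : (1 : ℝ) ≤ a 0 := by exact_mod_cast ha0
    exact load_le_of_sq hmono hL hb hlo hdom hh hf ha0 (hajK 0 (by omega)) (by norm_num) (by nlinarith) q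
  · -- the older caps s (ages ≥ ρ₀)
    exact load_le_of_sq hmono hL hb hlo hdom hh hf (hapos j hjr) (hajK j hjr) hspos (hcapk (a j) (haold j hj1 hjr)) q
  · -- the relative variation of the read of age a j
    rw [hO, hO]
    have hv := old_read_variation_of_bound hmono hL hb hlo hdom hh hf hL0 hg hgF hKL (hapos j hjr) (hajK j hjr) hd1 hdj hT hnn hle
    have e1 : 4 * (d : ℝ) * (L (a j) * h (m + a j) ^ 3 / 2) * T = 4 * (L (a j) * h (m + a j) ^ 3 / 2) * d * T := by ring
    simpa only [e1] using hv

/-- **THE YOUNGEST GAP AT RATIO 30, THE CHAIN AT RATIO 61** (`κ = 1∕5`, `s = 0.6165`): ages `a 0 ≥ 1` (ANY), `a 1 ≥ 30·a 0`, `a (j+1) ≥ 61·a j`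
(`j ≥ 1`), any number of them ⟹ `0 ≤ ε ≤ e` along every flow, every horizon, every damping of the self-consistent class. [folklore] -/
theorem flow_nonneg_youngest_separated_ages
    (hmono : ∀ u v : ℕ → ℝ, SeqBox γ u → SeqBox γ v → (∀ j, u j ≤ v j) → B u ≤ B v)
    (hL : ∀ k, 0 ≤ L k) (hb : 0 < b) (hlo : ∀ u, SeqBox γ u → b ≤ B u) (hdom : ∀ u, SeqBox γ u → ∑ k ∈ range K, L k * u k ≤ B u)
    (hh : SeqBox γ h) (hf : MemFlow B gIR h) (hg : ∀ t, 0 < g t ∧ g t ≤ 1)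
    (hgF : ∀ t, 1 ≤ g t * (1 + ∑ k ∈ range K, L k * h (t + k) ^ 3 / 2))
    {r : ℕ} {a : ℕ → ℕ} (hr : 1 ≤ r) (ha0 : 1 ≤ a 0) (haK : a (r - 1) < K) (hsep0 : 1 < r → 30 * a 0 ≤ a 1)
    (hsep : ∀ j, 1 ≤ j → j + 1 < r → 61 * a j ≤ a (j + 1)) (hLa : ∀ l, l < K → (∀ j, j < r → l ≠ a j) → L l = 0)
    {N : ℕ} {KL : ℕ → ℕ → ℕ → ℝ}
    (hKL : ∀ k n l, KL k n l = if 0 < k ∧ k < K ∧ l < k then L k * h (n + k) ^ 3 / 2 * ∏ t ∈ Ico (n + 1 + l) (n + k + 1), g t else 0)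
    {KA : ℕ → ℕ → ℕ → ℝ} {RA : ℕ → (ℕ → ℝ) → ℕ → ℝ}
    (hRA : ∀ i v m, RA i v m = ∑ l ∈ range K, KA i m l * v (m + 1 + l))
    (hKA : ∀ i m l, KA i m l = KL i m l + KA (i + 1) m l) (hKAtop : ∀ m l, KA K m l = 0)
    {e ε : ℕ → ℝ} (he0 : ∀ m, 0 ≤ e m) (hea : ∀ m, e (m + 1) ≤ e m)
    (hεt : ∀ m, N < m → ε m = 0) (hεrec : ∀ m, ε m = e m - RA 1 ε m) : ∀ m, 0 ≤ ε m ∧ ε m ≤ e m :=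
  flow_nonneg_youngest_separated_ages_param hmono hL hb hlo hdom hh hf hg hgF (κ := 1 / 5) (s := 1233 / 2000) (ρ₀ := 30) (R₀ := 61)
    (by norm_num) (by norm_num) (by norm_num) (by norm_num) (by norm_num) (by norm_num) (by norm_num) (by norm_num)
    hr ha0 haK hsep0 hsep hLa hKL hRA hKA hKAtop he0 hea hεt hεrec

/-- **THE YOUNGEST GAP AT RATIO 21, THE CHAIN AT RATIO 92** (`κ = 19∕200`, `s = 0.6175`). [folklore] -/
theorem flow_nonneg_youngest_separated_ages_wide
    (hmono : ∀ u v : ℕ → ℝ, SeqBox γ u → SeqBox γ v → (∀ j, u j ≤ v j) → B u ≤ B v)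
    (hL : ∀ k, 0 ≤ L k) (hb : 0 < b) (hlo : ∀ u, SeqBox γ u → b ≤ B u) (hdom : ∀ u, SeqBox γ u → ∑ k ∈ range K, L k * u k ≤ B u)
    (hh : SeqBox γ h) (hf : MemFlow B gIR h) (hg : ∀ t, 0 < g t ∧ g t ≤ 1)
    (hgF : ∀ t, 1 ≤ g t * (1 + ∑ k ∈ range K, L k * h (t + k) ^ 3 / 2))
    {r : ℕ} {a : ℕ → ℕ} (hr : 1 ≤ r) (ha0 : 1 ≤ a 0) (haK : a (r - 1) < K) (hsep0 : 1 < r → 21 * a 0 ≤ a 1)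
    (hsep : ∀ j, 1 ≤ j → j + 1 < r → 92 * a j ≤ a (j + 1)) (hLa : ∀ l, l < K → (∀ j, j < r → l ≠ a j) → L l = 0)
    {N : ℕ} {KL : ℕ → ℕ → ℕ → ℝ}
    (hKL : ∀ k n l, KL k n l = if 0 < k ∧ k < K ∧ l < k then L k * h (n + k) ^ 3 / 2 * ∏ t ∈ Ico (n + 1 + l) (n + k + 1), g t else 0)
    {KA : ℕ → ℕ → ℕ → ℝ} {RA : ℕ → (ℕ → ℝ) → ℕ → ℝ}
    (hRA : ∀ i v m, RA i v m = ∑ l ∈ range K, KA i m l * v (m + 1 + l))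
    (hKA : ∀ i m l, KA i m l = KL i m l + KA (i + 1) m l) (hKAtop : ∀ m l, KA K m l = 0)
    {e ε : ℕ → ℝ} (he0 : ∀ m, 0 ≤ e m) (hea : ∀ m, e (m + 1) ≤ e m)
    (hεt : ∀ m, N < m → ε m = 0) (hεrec : ∀ m, ε m = e m - RA 1 ε m) : ∀ m, 0 ≤ ε m ∧ ε m ≤ e m :=
  flow_nonneg_youngest_separated_ages_param hmono hL hb hlo hdom hh hf hg hgF (κ := 19 / 200) (s := 247 / 400) (ρ₀ := 21) (R₀ := 92)
    (by norm_num) (by norm_num) (by norm_num) (by norm_num) (by norm_num) (by norm_num) (by norm_num) (by norm_num)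
    hr ha0 haK hsep0 hsep hLa hKL hRA hKA hKAtop he0 hea hεt hεrec

/-! ## §2 The census young pair at every k₂ below a ×92 chain -/

/-- **THE CENSUS YOUNG PAIR `{1, k₂}` AT EVERY `k₂` BELOW A ×92 CHAIN, ANY NUMBER OF AGES.**  Profile carried by `{1, a 0, a 1, …, a (r−1)}` with
`a 0 = k₂ ≥ 2` ARBITRARY and `92·a j ≤ a (j+1)`: `0 ≤ ε ≤ e` at every pin, every horizon, every damping of the self-consistent class.  (`k₂ ≤ 20`: the pair
route (E95d) at `κ = 19∕200`, `p₀ = 11∕20`; `k₂ ≥ 21`: §1 `flow_nonneg_youngest_separated_ages_wide` with the ages `1, a 0, a 1, …`.) [folklore] -/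
theorem flow_nonneg_census_young_pair_every
    (hmono : ∀ u v : ℕ → ℝ, SeqBox γ u → SeqBox γ v → (∀ j, u j ≤ v j) → B u ≤ B v)
    (hL : ∀ k, 0 ≤ L k) (hb : 0 < b) (hlo : ∀ u, SeqBox γ u → b ≤ B u) (hdom : ∀ u, SeqBox γ u → ∑ k ∈ range K, L k * u k ≤ B u)
    (hh : SeqBox γ h) (hf : MemFlow B gIR h) (hg : ∀ t, 0 < g t ∧ g t ≤ 1)
    (hgF : ∀ t, 1 ≤ g t * (1 + ∑ k ∈ range K, L k * h (t + k) ^ 3 / 2))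
    {r : ℕ} {a : ℕ → ℕ} (hr : 1 ≤ r) (ha0 : 2 ≤ a 0) (haK : a (r - 1) < K)
    (hsep : ∀ j, j + 1 < r → 92 * a j ≤ a (j + 1)) (hLa : ∀ l, l < K → l ≠ 1 → (∀ j, j < r → l ≠ a j) → L l = 0)
    {N : ℕ} {KL : ℕ → ℕ → ℕ → ℝ}
    (hKL : ∀ k n l, KL k n l = if 0 < k ∧ k < K ∧ l < k then L k * h (n + k) ^ 3 / 2 * ∏ t ∈ Ico (n + 1 + l) (n + k + 1), g t else 0)
    {KA : ℕ → ℕ → ℕ → ℝ} {RA : ℕ → (ℕ → ℝ) → ℕ → ℝ}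
    (hRA : ∀ i v m, RA i v m = ∑ l ∈ range K, KA i m l * v (m + 1 + l))
    (hKA : ∀ i m l, KA i m l = KL i m l + KA (i + 1) m l) (hKAtop : ∀ m l, KA K m l = 0)
    {e ε : ℕ → ℝ} (he0 : ∀ m, 0 ≤ e m) (hea : ∀ m, e (m + 1) ≤ e m)
    (hεt : ∀ m, N < m → ε m = 0) (hεrec : ∀ m, ε m = e m - RA 1 ε m) : ∀ m, 0 ≤ ε m ∧ ε m ≤ e m := by
  by_cases h20 : a 0 ≤ 20
  · -- the pair route
    have hs : Real.sqrt 2 ≤ 310 / 219 := Real.sqrt_le_iff.mpr ⟨by norm_num, by norm_num⟩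
    have ha20 : (a 0 : ℝ) ≤ 20 := by exact_mod_cast h20
    refine flow_nonneg_young_pair_separated_ages_param hmono hL hb hlo hdom hh hf hg hgF (κ := 19 / 200) (p₀ := 11 / 20) (R₀ := 92)
      (by norm_num) (by norm_num) (by norm_num) (by norm_num) (by norm_num) ?_ hr ha0 (by nlinarith) haK hsep hLa hKL hRA hKA hKAtop
      he0 hea hεt hεrec
    rw [div_mul_eq_mul_div, div_le_one (by norm_num)]
    linarith
  · -- the single-young route with the ages 1, a 0, a 1, …
    have h21 : 21 ≤ a 0 := by omega
    obtain ⟨at', hat'⟩ : ∃ at' : ℕ → ℕ, ∀ i, at' i = if i = 0 then 1 else a (i - 1) := ⟨_, fun _ => rfl⟩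
    have hat0 : at' 0 = 1 := by rw [hat']; simp
    have hatS : ∀ j, at' (j + 1) = a j := fun j => by rw [hat']; simp
    have hat1 : at' 1 = a 0 := by rw [hat']; simp
    refine flow_nonneg_youngest_separated_ages_wide hmono hL hb hlo hdom hh hf hg hgF (r := r + 1) (a := at') (by omega) (le_of_eq hat0.symm)
      (by rw [show r + 1 - 1 = (r - 1) + 1 by omega, hatS]; exact haK) (fun _ => by rw [hat0, hat1]; omega)
      (fun j hj1 hjr => ?_) (fun l hl hne => ?_) hKL hRA hKA hKAtop he0 hea hεt hεrec
    · obtain ⟨i, rfl⟩ : ∃ i, j = i + 1 := ⟨j - 1, by omega⟩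
      rw [hatS, hatS]
      exact hsep i (by omega)
    · exact hLa l hl (by have := hne 0 (by omega); rwa [hat0] at this) fun j hj => by
        have := hne (j + 1) (by omega); rwa [hatS] at this

/-- **THE CENSUS FOUR AGES `{1, k₂, k₃, k₄}` WITH ANY `k₂`** (`2 ≤ k₂`, `k₃ ≥ 92k₂`, `k₄ ≥ 92k₃`, `k₄ < K`): `0 ≤ ε ≤ e` at every pin, every horizon, every
damping of the self-consistent class. [folklore] -/
theorem flow_nonneg_census_four_ages_every_young_pair
    (hmono : ∀ u v : ℕ → ℝ, SeqBox γ u → SeqBox γ v → (∀ j, u j ≤ v j) → B u ≤ B v)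
    (hL : ∀ k, 0 ≤ L k) (hb : 0 < b) (hlo : ∀ u, SeqBox γ u → b ≤ B u) (hdom : ∀ u, SeqBox γ u → ∑ k ∈ range K, L k * u k ≤ B u)
    (hh : SeqBox γ h) (hf : MemFlow B gIR h) (hg : ∀ t, 0 < g t ∧ g t ≤ 1)
    (hgF : ∀ t, 1 ≤ g t * (1 + ∑ k ∈ range K, L k * h (t + k) ^ 3 / 2))
    {k₂ k₃ k₄ : ℕ} (hk2 : 2 ≤ k₂) (hk3 : 92 * k₂ ≤ k₃) (hk4 : 92 * k₃ ≤ k₄) (hk4K : k₄ < K)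
    (hL4 : ∀ j, j < K → j ≠ 1 → j ≠ k₂ → j ≠ k₃ → j ≠ k₄ → L j = 0)
    {N : ℕ} {KL : ℕ → ℕ → ℕ → ℝ}
    (hKL : ∀ k n l, KL k n l = if 0 < k ∧ k < K ∧ l < k then L k * h (n + k) ^ 3 / 2 * ∏ t ∈ Ico (n + 1 + l) (n + k + 1), g t else 0)
    {KA : ℕ → ℕ → ℕ → ℝ} {RA : ℕ → (ℕ → ℝ) → ℕ → ℝ}
    (hRA : ∀ i v m, RA i v m = ∑ l ∈ range K, KA i m l * v (m + 1 + l))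
    (hKA : ∀ i m l, KA i m l = KL i m l + KA (i + 1) m l) (hKAtop : ∀ m l, KA K m l = 0)
    {e ε : ℕ → ℝ} (he0 : ∀ m, 0 ≤ e m) (hea : ∀ m, e (m + 1) ≤ e m)
    (hεt : ∀ m, N < m → ε m = 0) (hεrec : ∀ m, ε m = e m - RA 1 ε m) : ∀ m, 0 ≤ ε m ∧ ε m ≤ e m := by
  refine flow_nonneg_census_young_pair_every hmono hL hb hlo hdom hh hf hg hgF (r := 3)
    (a := fun j => if j = 0 then k₂ else if j = 1 then k₃ else k₄) (by norm_num) (by simpa using hk2)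
    (by simpa using hk4K) (fun j hj => ?_) (fun l hl hl1 hla => hL4 l hl hl1 ?_ ?_ ?_) hKL hRA hKA hKAtop he0 hea hεt hεrec
  · have : j = 0 ∨ j = 1 := by omega
    rcases this with rfl | rfl <;> simp <;> omega
  · simpa using hla 0 (by norm_num)
  · simpa using hla 1 (by norm_num)
  · simpa using hla 2 (by norm_num)

end Summit.QuantumFields.BalabanUV.Beta.EriceRemainderEnclosureHistoryAutonomyComparisonAgeCompositionYoungSeparatedAges

end
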